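import Summits.QuantumAdvantage.QuantumAdvantage.Theorems.AnchorDialMulti

/-!
# LocusDial — part 1 «Pieces» (cell decomp-qadv, seat lens-2, generation 16; supports item 26531 `ExactnessDial.PolyLossOddU3`)

§1–§5 and §9 of the g16 node «LocusDial» (HOME decomp-qadv-lens-2/g16/LocusDial.lean, record NODE-g16.md),
re-namespaced to `…Theorems.LocusDial`.  THE CUT by COVERING GEOMETRY of the deviation set `dev P x` (no
declarability, no stability): `Coverable m r S`, `FewLocus m r P` (a.e. `(m, r)`-coverable, exceptional mass
`≤ 2^{N-1}/log₂ N`), the pieces `FewLocusLoss3` (U, localisation) and `ManyLocusLoss3` (M, proliferation) = `T`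
restricted to either side, the node equation `node_iff : T ⟺ U ∧ M`, the assembly
`closes : U → M → DPLift3 → AdviceFreeQNC0Three` (BY NAME via `HolonomyDial.closes_T`), covering arithmetic, the
lattice against g15 (`U → MultiAnchorLoss3`, `NoMultiAnchorLoss3 → M`, the strip `U ⟺ MultiAnchorLoss3 ∧
FreeLocusLoss3`), the non-vacuity witnesses (`fewLocus_tPoly`, `not_fewLocus_acStrat`), and the M-side leaves
`ProlificAnchorLoss3` (necessary for `M`) and the aside `ManyLocusHalf3`.  Prop definitions = the node's pieces and
leaves only.  No `sorry`; standard axioms.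
-/

set_option linter.dupNamespace false

noncomputable section

open scoped Classical

namespace Summit.QuantumAdvantage.QuantumAdvantage.Theorems.LocusDial

open Finset
open Literature.Computability.QuantumComplexity Literature.Computability.QuantumComplexity.RingHLF
open Literature.Computability.MetaComplexity Literature.Computability.MetaComplexity.Smolensky
open Summit.QuantumAdvantage.AdviceFreeQNC0
open Summit.QuantumAdvantage.QuantumAdvantage.Theses (ExactnessDial.PolyLossOddU3 ExactnessDial.DPLift3)
open Summit.QuantumAdvantage.QuantumAdvantage.Theorems.HolonomyDial (gCond selP selP_mem selP_apply xorP xorP_mem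
  xorP_apply_bool tPoly tPoly_mem tPoly_apply mono_singleton_apply closes_T card_odd_le)
open Summit.QuantumAdvantage.QuantumAdvantage.Theorems.AnchorDial (flip2 flip2_flip2 flip2_apply_of_ne oddZeros_flip2
  card_filter_flip2 zpar_flip2 outB dev cN gCond_iff_cN win_iff devInd mpStrat devInd_mem mpStrat_mem devInd_apply
  rel_mpStrat_iff deg_bump4 loss_shape_mono real_tail card_odd_ge MAnchorable MultiAnchorLoss3 NoMultiAnchorLoss3
  multiAnchorLoss3_of_polyLossOddU3 noMultiAnchorLoss3_of_polyLossOddU3 polyLossOddU3_of_dichotomy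
  polyLossOddU3_iff_multiAnchor multiAnchorLoss3_slice_one mAnchorable_mono_m MovingPointerLoss3
  movingPointerLoss3_of_polyLossOddU3 fz fz_apply zpar_fz oddZeros_fz cN_fz sh sgN mod3_ne_two_iff)

variable {N : ℕ}

/-! ## §1  The cut: COVERING GEOMETRY of the deviation set (no declarability, no stability) -/

/-- a set of ring positions is **`(m, r)`-COVERABLE**: `m` windows `[k_j, k_j + r]` (linear order) cover it. -/
def Coverable (m r : ℕ) (S : Finset (Fin N)) : Prop :=
  ∃ kv : Fin m → ℕ, ∀ i ∈ S, ∃ j, kv j ≤ i.val ∧ i.val ≤ kv j + r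

/-- **FEW-LOCUS at `(m, r)`**: for all but a VANISHING fraction (`≤ 2^{N-1}/log₂ N`) of the odd class the strategy's
deviation set from the canonical guess is `(m, r)`-coverable.  A condition on the GEOMETRY of the bet only: where the
windows sit may depend on `x` in any way whatsoever (hashed, unstable, undeclarable locations allowed). -/
def FewLocus (m r : ℕ) (P : Fin N → CubeFn (ZMod 3) N) : Prop :=
  Nat.log 2 N * (univ.filter fun x : Fin N → Bool => OddZeros x ∧ ¬ Coverable m r (dev P x)).card ≤ 2 ^ (N - 1)

/-- **PIECE U (crux) `FewLocusLoss3` — `T` RESTRICTED TO FEW-LOCUS STRATEGIES** (LOCALISATION): for every `m, r, c`,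
every degree-`(log₂ n)^c` strategy whose bet is a.e. confined to `m` windows of width `r` — at ARBITRARY,
input-dependent, undeclared locations — loses a polynomial fraction of the odd class. -/
def FewLocusLoss3 : Prop :=
  ∃ C : ℕ, ∀ m r c : ℕ, ∃ n₀ : ℕ, ∀ n ≥ n₀, ∀ P : Fin n → CubeFn (ZMod 3) n,
    (∀ i, P i ∈ lowDeg (ZMod 3) n ((Nat.log 2 n) ^ c)) → FewLocus m r P →
      ((univ.filter fun x : Fin n → Bool => OddZeros x ∧ Rel x (fun i => decide (P i x = 1))).card : ℝ) ≤
        (1 - 1 / (n : ℝ) ^ C) * (2 : ℝ) ^ (n - 1)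

/-- **PIECE M (crux) `ManyLocusLoss3` — `T` RESTRICTED TO MANY-LOCUS STRATEGIES** (PROLIFERATION): for every `m, r, c`,
every degree-`(log₂ n)^c` strategy whose deviation set needs MORE than `m` windows of width `r` on a non-vanishing
(`> 2^{n-1}/log₂ n`) part of the odd class loses a polynomial fraction of the odd class. -/
def ManyLocusLoss3 : Prop :=
  ∃ C : ℕ, ∀ m r c : ℕ, ∃ n₀ : ℕ, ∀ n ≥ n₀, ∀ P : Fin n → CubeFn (ZMod 3) n,
    (∀ i, P i ∈ lowDeg (ZMod 3) n ((Nat.log 2 n) ^ c)) → ¬ FewLocus m r P →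
      ((univ.filter fun x : Fin n → Bool => OddZeros x ∧ Rel x (fun i => decide (P i x = 1))).card : ℝ) ≤
        (1 - 1 / (n : ℝ) ^ C) * (2 : ℝ) ^ (n - 1)

/-! ## §2  Node equation `T ⟺ U ∧ M` and `closes` -/

/-- `T → U` (restriction). -/
theorem fewLocusLoss3_of_polyLossOddU3 (h : ExactnessDial.PolyLossOddU3) : FewLocusLoss3 := by
  obtain ⟨C, hC⟩ := h
  refine ⟨C, fun _ _ c => ?_⟩
  obtain ⟨n₀, hn₀⟩ := hC c
  exact ⟨n₀, fun n hn P hP _ => hn₀ n hn P hP⟩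

/-- `T → M` (restriction). -/
theorem manyLocusLoss3_of_polyLossOddU3 (h : ExactnessDial.PolyLossOddU3) : ManyLocusLoss3 := by
  obtain ⟨C, hC⟩ := h
  refine ⟨C, fun _ _ c => ?_⟩
  obtain ⟨n₀, hn₀⟩ := hC c
  exact ⟨n₀, fun n hn P hP _ => hn₀ n hn P hP⟩

/-- **dichotomy `U ∧ M → T`**: at degree budget `c` split on `FewLocus c c` (any diagonal exhausting all `(m, r)`). -/
theorem polyLossOddU3_of_locus (hU : FewLocusLoss3) (hM : ManyLocusLoss3) : ExactnessDial.PolyLossOddU3 := by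
  obtain ⟨CU, hU⟩ := hU
  obtain ⟨CM, hM⟩ := hM
  refine ⟨max CU CM, fun c => ?_⟩
  obtain ⟨n₁, hn₁⟩ := hU c c c
  obtain ⟨n₂, hn₂⟩ := hM c c c
  refine ⟨max (max n₁ n₂) 1, fun n hn P hP => ?_⟩
  have hn1 : n₁ ≤ n := le_trans (le_trans (le_max_left _ _) (le_max_left _ _)) hn
  have hn2 : n₂ ≤ n := le_trans (le_trans (le_max_right _ _) (le_max_left _ _)) hn
  have h1 : 1 ≤ n := le_trans (le_max_right _ _) hn
  have hP0 : (0 : ℝ) ≤ (2 : ℝ) ^ (n - 1) := by positivity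
  by_cases hc : FewLocus c c P
  · exact loss_shape_mono h1 (le_max_left CU CM) _ _ hP0 (hn₁ n hn1 P hP hc)
  · exact loss_shape_mono h1 (le_max_right CU CM) _ _ hP0 (hn₂ n hn2 P hP hc)

/-- **NODE EQUATION**: `T ⟺ U ∧ M`. -/
theorem node_iff : ExactnessDial.PolyLossOddU3 ↔ FewLocusLoss3 ∧ ManyLocusLoss3 :=
  ⟨fun h => ⟨fewLocusLoss3_of_polyLossOddU3 h, manyLocusLoss3_of_polyLossOddU3 h⟩,
    fun h => polyLossOddU3_of_locus h.1 h.2⟩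

/-- **`closes`**: both pieces are consumed and the leaf `AdviceFreeQNC0Three` is reached BY NAME through the tree's
`HolonomyDial.closes_T` (with the cone's standing outer lift `DPLift3`). -/
theorem closes (hU : FewLocusLoss3) (hM : ManyLocusLoss3) (hD : ExactnessDial.DPLift3) : AdviceFreeQNC0Three :=
  closes_T (polyLossOddU3_of_locus hU hM) hD

/-! ## §3  Covering arithmetic -/

/-- LocusDialPieces helper `coverable_empty` (decomp-qadv land package; see the module docstring). -/
theorem coverable_empty (m r : ℕ) : Coverable m r (∅ : Finset (Fin N)) :=
  ⟨fun _ => 0, fun i hi => absurd hi (Finset.notMem_empty i)⟩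

/-- LocusDialPieces helper `coverable_mono` (decomp-qadv land package; see the module docstring). -/
theorem coverable_mono {m r : ℕ} {S T : Finset (Fin N)} (hST : S ⊆ T) (h : Coverable m r T) : Coverable m r S := by
  obtain ⟨kv, hkv⟩ := h
  exact ⟨kv, fun i hi => hkv i (hST hi)⟩

/-- LocusDialPieces helper `coverable_singleton` (decomp-qadv land package; see the module docstring). -/
theorem coverable_singleton {m : ℕ} (hm : 1 ≤ m) (r : ℕ) (k : Fin N) : Coverable m r ({k} : Finset (Fin N)) :=
  ⟨fun _ => k.val, fun i hi => ⟨⟨0, hm⟩, by rw [mem_singleton] at hi; subst hi; exact ⟨le_rfl, Nat.le_add_right _ _⟩⟩⟩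

/-- LocusDialPieces helper `coverable_mono_m` (decomp-qadv land package; see the module docstring). -/
theorem coverable_mono_m {m m' r : ℕ} (hm : m ≤ m') (hm0 : 1 ≤ m) {S : Finset (Fin N)} (h : Coverable m r S) :
    Coverable m' r S := by
  obtain ⟨kv, hkv⟩ := h
  refine ⟨fun j => if hj : j.val < m then kv ⟨j.val, hj⟩ else kv ⟨0, hm0⟩, fun i hi => ?_⟩
  obtain ⟨j, hj⟩ := hkv i hi
  exact ⟨⟨j.val, lt_of_lt_of_le j.isLt hm⟩, by simp [j.isLt, hj]⟩

/-- LocusDialPieces helper `window_card_le` (decomp-qadv land package; see the module docstring). -/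
theorem window_card_le (a r : ℕ) : (univ.filter fun i : Fin N => a ≤ i.val ∧ i.val ≤ a + r).card ≤ r + 1 := by
  calc (univ.filter fun i : Fin N => a ≤ i.val ∧ i.val ≤ a + r).card ≤ (Finset.Icc a (a + r)).card :=
        Finset.card_le_card_of_injOn (fun i => i.val) (fun i hi => by
          rw [mem_coe, mem_filter] at hi; rw [mem_coe, Finset.mem_Icc]; exact hi.2)
          (fun i _ j _ h => Fin.ext h)
    _ = r + 1 := by rw [Nat.card_Icc]; omega

/-- `m` windows of width `r` cover at most `m·(r+1)` positions. -/
theorem Coverable.card_le {m r : ℕ} {S : Finset (Fin N)} (h : Coverable m r S) : S.card ≤ m * (r + 1) := by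
  obtain ⟨kv, hkv⟩ := h
  calc S.card ≤ ((univ : Finset (Fin m)).biUnion fun j =>
          univ.filter fun i : Fin N => kv j ≤ i.val ∧ i.val ≤ kv j + r).card :=
        card_le_card fun i hi => by
          obtain ⟨j, hj⟩ := hkv i hi
          exact mem_biUnion.2 ⟨j, mem_univ _, mem_filter.2 ⟨mem_univ _, hj⟩⟩
    _ ≤ ∑ j, (univ.filter fun i : Fin N => kv j ≤ i.val ∧ i.val ≤ kv j + r).card := card_biUnion_le
    _ ≤ ∑ _j : Fin m, (r + 1) := sum_le_sum fun j _ => window_card_le _ _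
    _ = m * (r + 1) := by rw [sum_const, card_univ, Fintype.card_fin, smul_eq_mul]

/-- LocusDialPieces helper `not_coverable_univ` (decomp-qadv land package; see the module docstring). -/
theorem not_coverable_univ {m r : ℕ} (h : m * (r + 1) < N) : ¬ Coverable m r (univ : Finset (Fin N)) := fun hc => by
  have h' := hc.card_le
  rw [card_univ, Fintype.card_fin] at h'
  omega

/-! ## §4  The lattice against g15: `U → W₁₅`, `R₁₅ → M`, and the FREE-LOCUS strip -/

/-- an `m`-anchorable strategy (g15: `m` declarable, a.e.-unique, flip-stable anchor families confine the bet) is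
few-locus — the cut of this node FORGETS the declaration. -/
theorem fewLocus_of_mAnchorable {m r c : ℕ} {P : Fin N → CubeFn (ZMod 3) N} (h : MAnchorable m r c P) :
    FewLocus m r P := by
  obtain ⟨A, -, -, -, hN⟩ := h
  refine le_trans (Nat.mul_le_mul_left _ (card_le_card fun x hx => ?_)) hN
  rw [mem_filter] at hx ⊢
  refine ⟨hx.1, hx.2.1, fun ⟨kv, _, hcov⟩ => hx.2.2 ⟨fun j => (kv j).val, hcov⟩⟩

/-- `U` DOMINATES g15's special piece `W₁₅ = MultiAnchorLoss3` (PROVED for every `m` in the g15 node; tree parts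
24–27 landing). -/
theorem multiAnchorLoss3_of_fewLocusLoss3 (h : FewLocusLoss3) : MultiAnchorLoss3 := by
  obtain ⟨C, hC⟩ := h
  refine ⟨C, fun m r c => ?_⟩
  obtain ⟨n₀, hn₀⟩ := hC m r c
  exact ⟨n₀, fun n hn P hP hA => hn₀ n hn P hP (fewLocus_of_mAnchorable hA)⟩

/-- g15's residual `R₁₅ = NoMultiAnchorLoss3` (≡ `T`) GIVES `M`: the many-locus class sits inside the
non-anchorable class. -/
theorem manyLocusLoss3_of_noMultiAnchorLoss3 (h : NoMultiAnchorLoss3) : ManyLocusLoss3 := by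
  obtain ⟨C, hC⟩ := h
  refine ⟨C, fun m r c => ?_⟩
  obtain ⟨n₀, hn₀⟩ := hC m r c
  exact ⟨n₀, fun n hn P hP hF => hn₀ n hn P hP fun hA => hF (fewLocus_of_mAnchorable hA)⟩

/-- **the FREE-LOCUS strip** `FreeLocusLoss3`: `T` restricted to strategies that are few-locus but NOT `m`-anchorable —
the bet sits in few windows whose locations admit NO polylog-degree, a.e.-unique, flip-stable declaration
(hashed / unstable / undeclarable loci).  This is where the open content of `U` lives (`fewLocusLoss3_iff_strip`). -/
def FreeLocusLoss3 : Prop :=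
  ∃ C : ℕ, ∀ m r c : ℕ, ∃ n₀ : ℕ, ∀ n ≥ n₀, ∀ P : Fin n → CubeFn (ZMod 3) n,
    (∀ i, P i ∈ lowDeg (ZMod 3) n ((Nat.log 2 n) ^ c)) → FewLocus m r P → ¬ MAnchorable m r c P →
      ((univ.filter fun x : Fin n → Bool => OddZeros x ∧ Rel x (fun i => decide (P i x = 1))).card : ℝ) ≤
        (1 - 1 / (n : ℝ) ^ C) * (2 : ℝ) ^ (n - 1)

/-- `U ⟺ W₁₅ ∧ strip`: modulo the PROVED g15 law, piece `U` IS the free-locus strip. -/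
theorem fewLocusLoss3_iff_strip : FewLocusLoss3 ↔ MultiAnchorLoss3 ∧ FreeLocusLoss3 := by
  refine ⟨fun h => ⟨multiAnchorLoss3_of_fewLocusLoss3 h, ?_⟩, fun ⟨hW, hS⟩ => ?_⟩
  · obtain ⟨C, hC⟩ := h
    refine ⟨C, fun m r c => ?_⟩
    obtain ⟨n₀, hn₀⟩ := hC m r c
    exact ⟨n₀, fun n hn P hP hF _ => hn₀ n hn P hP hF⟩
  · obtain ⟨CW, hW⟩ := hW
    obtain ⟨CS, hS⟩ := hS
    refine ⟨max CW CS, fun m r c => ?_⟩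
    obtain ⟨n₁, hn₁⟩ := hW m r c
    obtain ⟨n₂, hn₂⟩ := hS m r c
    refine ⟨max (max n₁ n₂) 1, fun n hn P hP hF => ?_⟩
    have hn1 : n₁ ≤ n := le_trans (le_trans (le_max_left _ _) (le_max_left _ _)) hn
    have hn2 : n₂ ≤ n := le_trans (le_trans (le_max_right _ _) (le_max_left _ _)) hn
    have h1 : 1 ≤ n := le_trans (le_max_right _ _) hn
    have hP0 : (0 : ℝ) ≤ (2 : ℝ) ^ (n - 1) := by positivity
    by_cases hA : MAnchorable m r c P
    · exact loss_shape_mono h1 (le_max_left CW CS) _ _ hP0 (hn₁ n hn1 P hP hA)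
    · exact loss_shape_mono h1 (le_max_right CW CS) _ _ hP0 (hn₂ n hn2 P hP hF hA)


/-! ## §5  Non-vacuity: both classes contain polylog-degree strategies -/

/-- LocusDialPieces helper `two_le_logpow` (decomp-qadv land package; see the module docstring). -/
theorem two_le_logpow (hN : 4 ≤ N) {c : ℕ} (hc : 1 ≤ c) : 2 ≤ (Nat.log 2 N) ^ c := by
  have hL : 2 ≤ Nat.log 2 N := Nat.le_log_of_pow_le (by norm_num) (by norm_num; omega)
  calc 2 ≤ Nat.log 2 N := hL
    _ = (Nat.log 2 N) ^ 1 := (pow_one _).symm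
    _ ≤ (Nat.log 2 N) ^ c := Nat.pow_le_pow_right (by omega) hc

/-- the canonical strategy `t(x)` (degree `2`) never deviates. -/
theorem dev_tPoly (x : Fin N → Bool) : dev (fun i : Fin N => tPoly i) x = ∅ := by
  refine filter_eq_empty_iff.2 fun i _ => ?_
  show ¬ (decide (tPoly i x = 1) ≠ tGuess x i)
  rw [tPoly_apply]
  cases tGuess x i <;> simp

/-- the canonical strategy is few-locus at every `(m, r)` with EMPTY exceptional set. -/
theorem fewLocus_tPoly (m r : ℕ) : FewLocus m r (fun i : Fin N => tPoly i) := by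
  unfold FewLocus
  have h0 : (univ.filter fun x : Fin N → Bool =>
      OddZeros x ∧ ¬ Coverable m r (dev (fun i : Fin N => tPoly i) x)) = ∅ :=
    filter_eq_empty_iff.2 fun x _ hx => hx.2 (by rw [dev_tPoly]; exact coverable_empty m r)
  rw [h0, card_empty, mul_zero]
  exact Nat.zero_le _

/-- the ANTI-CANONICAL strategy `1 - t(x)` (degree `2`): deviates EVERYWHERE. -/
def acStrat (i : Fin N) : CubeFn (ZMod 3) N := 1 - tPoly i

/-- LocusDialPieces helper `acStrat_mem` (decomp-qadv land package; see the module docstring). -/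
theorem acStrat_mem (i : Fin N) : acStrat i ∈ lowDeg (ZMod 3) N 2 :=
  Submodule.sub_mem _ (one_mem_lowDeg _) (tPoly_mem i)

/-- LocusDialPieces helper `dev_acStrat` (decomp-qadv land package; see the module docstring). -/
theorem dev_acStrat (x : Fin N → Bool) : dev (fun i : Fin N => acStrat i) x = univ := by
  refine filter_eq_self.2 fun i _ => ?_
  show decide ((1 - tPoly i) x = 1) ≠ tGuess x i
  rw [Pi.sub_apply, Pi.one_apply, tPoly_apply]
  cases tGuess x i <;> decide

/-- the anti-canonical strategy is many-locus at `(m, r)` as soon as `m(r+1) < N` (and `N ≥ 4`): the FEW-LOCUS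
hypothesis of `U` is not vacuously false and the class of `M` is not empty. -/
theorem not_fewLocus_acStrat {m r : ℕ} (hN : 4 ≤ N) (hmr : m * (r + 1) < N) :
    ¬ FewLocus m r (fun i : Fin N => acStrat i) := by
  unfold FewLocus
  have hall : (univ.filter fun x : Fin N → Bool =>
      OddZeros x ∧ ¬ Coverable m r (dev (fun i : Fin N => acStrat i) x)) =
      univ.filter fun x : Fin N → Bool => OddZeros x := filter_congr fun x _ => by
    rw [dev_acStrat]; exact ⟨fun h => h.1, fun h => ⟨h, not_coverable_univ hmr⟩⟩
  rw [hall]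
  have hL : 2 ≤ Nat.log 2 N := Nat.le_log_of_pow_le (by norm_num) (by norm_num; omega)
  have hO := card_odd_ge (N := N) (by omega)
  have hpos : 0 < 2 ^ (N - 1) := by positivity
  intro h
  have h2 : 2 * 2 ^ (N - 1) ≤ 2 ^ (N - 1) := le_trans (Nat.mul_le_mul hL hO) h
  omega

/-! ## §9  Leaves under `M` -/

/-- the slowly growing anchor number `μ(n) = log₂ log₂ log₂ n`. -/
def mu (n : ℕ) : ℕ := Nat.log 2 (Nat.log 2 (Nat.log 2 n))

/-- **`ProlificAnchorLoss3`** (ATTACKABLE leaf under `M`): `T` restricted to strategies that are many-locus at `(m, r)`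
yet `μ(n)`-ANCHORABLE — g15's declarable, a.e.-unique, flip-stable anchor families, but UNBOUNDEDLY MANY of them
(`μ(n) → ∞`).  NECESSARY for `M` (`prolificAnchorLoss3_of_manyLocusLoss3`).  The g15 engine (`multiAnchor_loss`: loss
`≥ 2^{-(4m+14)}` for `m`-anchorable strategies once `log₂ n ≥ 2^{O(m)}`) should run verbatim at `m = μ(n)`: loss
`≥ 2^{-14}(log₂ log₂ n)^{-4} ≥ n^{-1}` — threshold bookkeeping, no new idea (INSTRUMENTABLE). -/
def ProlificAnchorLoss3 : Prop :=
  ∃ C : ℕ, ∀ m r c : ℕ, ∃ n₀ : ℕ, ∀ n ≥ n₀, ∀ P : Fin n → CubeFn (ZMod 3) n,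
    (∀ i, P i ∈ lowDeg (ZMod 3) n ((Nat.log 2 n) ^ c)) → ¬ FewLocus m r P → MAnchorable (mu n) r c P →
      ((univ.filter fun x : Fin n → Bool => OddZeros x ∧ Rel x (fun i => decide (P i x = 1))).card : ℝ) ≤
        (1 - 1 / (n : ℝ) ^ C) * (2 : ℝ) ^ (n - 1)

/-- `M → ProlificAnchorLoss3` (restriction). -/
theorem prolificAnchorLoss3_of_manyLocusLoss3 (h : ManyLocusLoss3) : ProlificAnchorLoss3 := by
  obtain ⟨C, hC⟩ := h
  refine ⟨C, fun m r c => ?_⟩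
  obtain ⟨n₀, hn₀⟩ := hC m r c
  exact ⟨n₀, fun n hn P hP hF _ => hn₀ n hn P hP hF⟩

/-- **`ManyLocusHalf3`** (ASIDE · the conjectured STRONG FORM on the proliferation side · UNDECIDED, census test): for
every precision `k` there is an anchor number `m` such that every polylog-degree strategy whose deviation set is,
a.e., NOT coverable by `m` windows (of any fixed width `r`) wins at most `1/2 + 1/(k+1)` of the odd class — «a bet
spread over many far-apart loci is an XOR of many nearly independent `2/3`-coins» (value `(1 - (-1/3)^m)/2 → 1/2` for
`m` FIXED far-apart single deviations).  Strictly stronger than `M` on the purely many-locus class; not a conjunct of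
the node. -/
def ManyLocusHalf3 : Prop :=
  ∀ k : ℕ, ∃ m : ℕ, ∀ r c : ℕ, ∃ n₀ : ℕ, ∀ n ≥ n₀, ∀ P : Fin n → CubeFn (ZMod 3) n,
    (∀ i, P i ∈ lowDeg (ZMod 3) n ((Nat.log 2 n) ^ c)) →
    Nat.log 2 n * (univ.filter fun x : Fin n → Bool => OddZeros x ∧ Coverable m r (dev P x)).card ≤ 2 ^ (n - 1) →
      2 * (k + 1) * (univ.filter fun x : Fin n → Bool => OddZeros x ∧ Rel x (fun i => decide (P i x = 1))).card ≤
        (k + 3) * 2 ^ (n - 1)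


end Summit.QuantumAdvantage.QuantumAdvantage.Theorems.LocusDial

end
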